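import Literature.Combinatorics.StablePolynomials.SupportJumpSystem
import Literature.Combinatorics.StablePolynomials.SamePhase
import Literature.Combinatorics.LorentzianPolynomials.SupportMatroid
import Literature.Combinatorics.LorentzianPolynomials.HodgeRiemann
import HarnessLib

/-!
# Homogeneous stable polynomials are Lorentzian: `S^d_n ⊆ M^d_n` and `S^d_n ⊆ L^d_n` in every degree
# (Brändén–Huh 2020, Prop. 2.2; Brändén 2007, Cor. 3.4 = Choe–Oxley–Sokal–Wagner, Thm. 7.1)

Layer `Literature/Combinatorics/LorentzianPolynomials`, namespace `Literature.Combinatorics.LorentzianPolynomials`;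
lane `lit-hodgefound` (Track 2 foundations library), seat p16, generation 30 (row g30-#2). Joins
`StablePolynomials/SupportJumpSystem.lean` (Brändén 2007, Thm. 3.2: the support of a polynomial with the half-plane
property is a jump system — `IsJumpSystem`, `HasHalfPlaneProperty.isJumpSystem_support`,
`IsRealStable.isJumpSystem_support`) with the lane's Lorentzian files: `Basic.lean` (`IsMConvex`, Definition 2.6
`lorentzian σ d`, `mem_lorentzian_iff_forall_iterPderiv`, `iterPderiv`), `StableQuadratic.lean`
(`mem_lorentzian_two_of_isRealStable`, Prop. 2.2 in degree `2`), `MathlibMatroid.lean` / `SupportMatroid.lean`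
(`isMConvex_iff_exists_basesExp_eq`, whose module docstring carried "TODO(general form): COSW in every degree needs
'stable ⟹ Lorentzian' (Prop. 2.2) beyond degree `2`" — discharged here) and `HodgeRiemann.lean` (Thm. 2.16 (2)).

## Sources (verbatim)

P. Brändén, J. Huh, *Lorentzian polynomials* [BrandenHuh2019] (held `paper:arxiv-1902.03719`), §2.1: "Let `S^d_n` be the
set of degree `d` homogeneous stable polynomials in `n` variables with nonnegative coefficients. […] a polynomial `f`
[…] is stable if `f` is non-vanishing on `ℋⁿ` or identically zero". **Proposition 2.2.** "Any polynomial in `S^d_n` is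
Lorentzian." §2.2 (p. 11): "We write `M^d_n` for the set of all degree `d` homogeneous polynomials in
`ℝ_{≥0}[w₁, …, wₙ]` whose supports are M-convex. […] It follows from [Brä07] that `S^d_n ⊆ M^d_n`." Definition 2.6:
"`L^d_n = {f ∈ M^d_n | ∂^α f ∈ L²_n for every α ∈ Δ^{d-2}_n}`", with "`L²_n = S²_n`". §2.3 **Proposition 2.14.** "If
`f` is in `S^d_n ∖ 0`, then `𝓗_f(w)` has exactly one positive eigenvalue for all `w ∈ ℝⁿ_{>0}`." §2.4 (after
Thm. 2.23): "Theorem 2.23 extends the following theorem of Choe et al. [COSW04]: If `f` is a nonzero homogeneous stable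
multi-affine polynomial, then the support of `f` is the set of bases of a matroid."
P. Brändén, *Polynomials with the half-plane property and matroid theory* [Branden2007], §2: "sets of bases of matroids
are precisely the delta-matroids for which all the members of `𝓕` have the same cardinality"; **Theorem 3.2.** "Suppose
that `f` has the half-plane property. Then the support of `f` is a jump system." **Corollary 3.4.** "The support of a
multi-affine and homogeneous polynomial with the half-plane property is the set of bases of a matroid."

## What is here

* §1 **`isMConvex_of_isJumpSystem`**: a jump system all of whose points have the same degree `d` is M-convex (the
  exchange property: the step `-eᵢ` leaves the degree-`d` layer, so the two-step axiom must return to it by `+eⱼ`).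
* §2 **`S^d_n ⊆ M^d_n`**: `isMConvex_support_of_isUpperHalfPlaneStable`, `isMConvex_support_of_hasHalfPlaneProperty`,
  `isMConvex_support_of_isRealStable` (homogeneous stable polynomials have M-convex support).
* §3 `isRealStable_pderiv_or_eq_zero`, `isRealStable_iterPderiv_or_eq_zero` (`∂^α` of a real stable polynomial is real
  stable or `0`; Gauss–Lucas through `map (algebraMap ℝ ℂ)`).
* §4 **Proposition 2.2** `mem_lorentzian_of_isRealStable` (a degree-`d` form with nonnegative coefficients which is real
  stable is in `L^d_n`) and `mem_lorentzian_of_eq_zero_or_isRealStable` (Brändén–Huh's "stable or identically zero").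
* §5 **Proposition 2.14, first sentence** `sigPos_hessianAt_eq_one_of_isRealStable` (through Thm. 2.16 (2) of
  `HodgeRiemann.lean`).
* §6 **Brändén 2007 Cor. 3.4 = [COSW04] Thm. 7.1 in every degree**: `exists_basesExp_eq_support_of_hasHalfPlaneProperty`,
  `exists_basesExp_eq_support_of_isUpperHalfPlaneStable`, `exists_basesExp_eq_support_of_isRealStable_of_isHomogeneous`
  (support of a nonzero homogeneous multi-affine polynomial with the half-plane property = the set of bases of a Mathlib
  `Matroid σ`), upgrading `SupportMatroid.exists_basesExp_eq_support_of_isRealStable` (degree `2`).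

* §7 **Proposition 2.2 without the sign hypothesis**: by [COSW04] Thm. 6.1 (the same-phase theorem, tree
  `StablePolynomials/SamePhase.lean`, `IsRealStable.coeff_nonneg_or_nonpos`) a homogeneous real stable polynomial has
  coefficients of one sign, so `f` or `-f` lies in `L^d_n` (`mem_lorentzian_or_neg_mem_lorentzian_of_isRealStable`).

Theorems only (no definition, no named fact; net debt 0). Not here: the second sentence of Prop. 2.14 (interior of
`S^d_n`); Prop. 4.24 (strongly Rayleigh measures) is `StronglyRayleighMeasures.lean`.

## References

* [BrandenHuh2019] P. Brändén, J. Huh, *Lorentzian polynomials*, Ann. of Math. (2) 192 (2020) 821–891, arXiv:1902.03719 —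
  §2.1 Prop. 2.2, §2.2 (p. 11, `S^d_n ⊆ M^d_n`), Def. 2.6, §2.3 Prop. 2.14, §2.4 (after Thm. 2.23).
* [Branden2007] P. Brändén, *Polynomials with the half-plane property and matroid theory*, Adv. Math. 216 (2007)
  302–320 — §2, Thm. 3.2, Cor. 3.4.
* [ChoeOxleySokalWagner2004] Y.-B. Choe, J. G. Oxley, A. D. Sokal, D. G. Wagner, *Homogeneous multivariate polynomials
  with the half-plane property*, Adv. Appl. Math. 32 (2004) 88–187 — Thm. 7.1.
-/

noncomputable section

open MvPolynomial Finsupp Finset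
open Literature.Combinatorics.StablePolynomials

namespace Literature.Combinatorics.LorentzianPolynomials

variable {σ : Type*}

/-! ## §1 Jump systems of constant degree are M-convex -/

section JumpToMConvex

/-- **A jump system inside a layer `Δ^d_n` is M-convex** ("sets of bases of matroids are precisely the delta-matroids
for which all the members of `𝓕` have the same cardinality", in the version for multisets / `ℕⁿ`): if every point of
the jump system `J` has degree `d`, then `J` has the exchange property — for `α, β ∈ J` and `βᵢ < αᵢ` the step `α - eᵢ`
leaves `J`, so the two-step axiom provides `α - eᵢ + eⱼ ∈ J` with `αⱼ < βⱼ`. [cite: Branden2007, §2 (delta-matroids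
of constant cardinality are sets of bases of matroids)] [cite: BrandenHuh2019, §2.2 (p. 11, "`S^d_n ⊆ M^d_n`")] -/
theorem isMConvex_of_isJumpSystem {J : Set (σ →₀ ℕ)} (hJ : IsJumpSystem J) {d : ℕ}
    (hd : ∀ α ∈ J, α.degree = d) : IsMConvex J := by
  classical
  intro α β hα hβ i hi
  have hαi : α i ≠ 0 := by omega
  set γ := α - single i 1 with hγ
  have hαγ : α = γ + single i 1 := (sub_add_single_one_cancel hαi).symm
  have hstep : IsStep α β γ := isStep_of_eq_add_single hi hαγ
  have hγdeg : γ.degree + 1 = d := by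
    rw [← hd α hα]
    conv_rhs => rw [hαγ]
    rw [map_add, degree_single]
  have hγJ : γ ∉ J := fun h => by
    have := hd γ h
    omega
  obtain ⟨δ, hδstep, hδJ⟩ := hJ hα hβ hstep hγJ
  obtain ⟨j, ⟨hlt, rfl⟩ | ⟨_, hγδ⟩⟩ := hδstep
  · have hji : j ≠ i := by
      rintro rfl
      rw [hαγ, Finsupp.add_apply, single_eq_same] at hi
      omega
    refine ⟨j, ?_, hδJ⟩
    rw [hαγ, Finsupp.add_apply, single_apply, if_neg hji.symm, add_zero]
    exact hlt
  · exfalso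
    have h1 := hd δ hδJ
    have h2 : γ.degree = δ.degree + 1 := by rw [hγδ, map_add, degree_single]
    omega

end JumpToMConvex

/-! ## §2 `S^d_n ⊆ M^d_n`: homogeneous stable polynomials have M-convex support -/

section StableMConvex

variable [Fintype σ] [DecidableEq σ]

/-- **`S^d_n ⊆ M^d_n` (complex coefficients)**: the support of a homogeneous upper half-plane stable polynomial is
M-convex. [cite: BrandenHuh2019, §2.2 (p. 11, "It follows from [Brä07] that `S^d_n ⊆ M^d_n`")]
[cite: Branden2007, §3 Thm. 3.2] -/
theorem isMConvex_support_of_isUpperHalfPlaneStable {p : MvPolynomial σ ℂ} (hp : IsUpperHalfPlaneStable p) {d : ℕ}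
    (hhom : p.IsHomogeneous d) : IsMConvex {m : σ →₀ ℕ | coeff m p ≠ 0} :=
  isMConvex_of_isJumpSystem hp.isJumpSystem_support fun α hα => by
    by_contra hne
    exact hα (hhom.coeff_eq_zero hne)

/-- **`S^d_n ⊆ M^d_n` for the half-plane property**: the support of a homogeneous polynomial with the half-plane
property is M-convex. [cite: Branden2007, §3 Thm. 3.2, Cor. 3.4] [cite: BrandenHuh2019, §2.2 (p. 11)] -/
theorem isMConvex_support_of_hasHalfPlaneProperty {p : MvPolynomial σ ℂ} (hp : HasHalfPlaneProperty p) {d : ℕ}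
    (hhom : p.IsHomogeneous d) : IsMConvex {m : σ →₀ ℕ | coeff m p ≠ 0} :=
  isMConvex_of_isJumpSystem hp.isJumpSystem_support fun α hα => by
    by_contra hne
    exact hα (hhom.coeff_eq_zero hne)

/-- **`S^d_n ⊆ M^d_n`**: the support of a homogeneous real stable polynomial is M-convex.
[cite: BrandenHuh2019, §2.2 (p. 11, "It follows from [Brä07] that `S^d_n ⊆ M^d_n`")] [cite: Branden2007, §3 Thm. 3.2] -/
theorem isMConvex_support_of_isRealStable {f : MvPolynomial σ ℝ} (hf : IsRealStable f) {d : ℕ}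
    (hhom : f.IsHomogeneous d) : IsMConvex {m : σ →₀ ℕ | coeff m f ≠ 0} :=
  isMConvex_of_isJumpSystem hf.isJumpSystem_support fun α hα => by
    by_contra hne
    exact hα (hhom.coeff_eq_zero hne)

end StableMConvex

/-! ## §3 Derivatives of real stable polynomials -/

section Derivatives

variable [Fintype σ] [DecidableEq σ]

/-- `∂ᵢ` of a real stable polynomial is real stable or zero (Gauss–Lucas, through the complexification).
[cite: BrandenHuh2019, §2.1 (p. 9, "The derivative `∂₁ f` is stable")] [cite: Branden2007, §3 Prop. 3.1] -/
theorem isRealStable_pderiv_or_eq_zero {f : MvPolynomial σ ℝ} (hf : IsRealStable f) (i : σ) :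
    pderiv i f = 0 ∨ IsRealStable (pderiv i f) := by
  have h := IsUpperHalfPlaneStable.pderiv hf i
  rw [pderiv_map] at h
  rcases h with h | h
  · left
    exact map_injective (algebraMap ℝ ℂ) (algebraMap ℝ ℂ).injective (by rw [h, map_zero])
  · exact Or.inr h

/-- `∂^α` of a real stable polynomial is real stable or zero. [cite: BrandenHuh2019, §2.1 (p. 9), §2.2 Def. 2.6]
[cite: Branden2007, §3 Prop. 3.1] -/
theorem isRealStable_iterPderiv_or_eq_zero {f : MvPolynomial σ ℝ} (hf : IsRealStable f) (α : σ →₀ ℕ) :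
    iterPderiv α f = 0 ∨ IsRealStable (iterPderiv α f) := by
  suffices H : ∀ (n : ℕ) (α : σ →₀ ℕ), α.degree = n → iterPderiv α f = 0 ∨ IsRealStable (iterPderiv α f) from
    H _ α rfl
  intro n
  induction n with
  | zero =>
    intro α hα
    rw [(Finsupp.degree_eq_zero_iff α).1 hα, iterPderiv_zero]
    exact Or.inr hf
  | succ n ih =>
    intro α hα
    have hα0 : α ≠ 0 := fun h => by
      rw [h, map_zero] at hα
      exact Nat.succ_ne_zero n hα.symm
    obtain ⟨i, hi⟩ : ∃ i, α i ≠ 0 := by simpa using DFunLike.ne_iff.1 hα0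
    have hsplit : α - single i 1 + single i 1 = α := sub_add_single_one_cancel hi
    have hdeg : (α - single i 1).degree = n := by
      have := congrArg Finsupp.degree hsplit
      rw [map_add, degree_single, hα] at this
      omega
    rw [← hsplit, iterPderiv_add_single]
    rcases ih _ hdeg with h | h
    · left
      rw [h, map_zero]
    · exact isRealStable_pderiv_or_eq_zero h i

end Derivatives

/-! ## §4 Proposition 2.2: `S^d_n ⊆ L^d_n` -/

section StableLorentzian

variable [Fintype σ] [DecidableEq σ]

/-- **Brändén–Huh, Proposition 2.2: "Any polynomial in `S^d_n` is Lorentzian"** — for the tree's Definition-2.6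
`lorentzian σ d`: a degree-`d` homogeneous real stable polynomial with nonnegative coefficients is in `L^d_n`. Proof on
Definition 2.6: the support is M-convex (`S^d_n ⊆ M^d_n`, Brändén 2007), and every `∂^α f`, `α ∈ Δ^{d-2}_n`, is a
stable-or-zero quadratic form with nonnegative coefficients, hence in `L²_n = S²_n`
(`mem_lorentzian_two_of_isRealStable`). [cite: BrandenHuh2019, §2.1 Prop. 2.2; §2.2 Def. 2.6 and p. 11] -/
theorem mem_lorentzian_of_isRealStable {f : MvPolynomial σ ℝ} {d : ℕ} (hhom : f.IsHomogeneous d)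
    (hnn : ∀ m, 0 ≤ coeff m f) (hf : IsRealStable f) : f ∈ lorentzian σ d := by
  match d, hhom with
  | 0, hhom => exact mem_lorentzian_zero.2 ⟨hhom, hnn⟩
  | 1, hhom => exact mem_lorentzian_one.2 ⟨hhom, hnn⟩
  | m + 2, hhom =>
    refine mem_lorentzian_iff_forall_iterPderiv.2 ⟨⟨hhom, hnn, isMConvex_support_of_isRealStable hf hhom⟩,
      fun α hα => ?_⟩
    have hhom2 : (iterPderiv α f).IsHomogeneous 2 :=
      IsHomogeneous.iterPderiv α (by rw [hα, add_comm]; exact hhom)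
    rcases isRealStable_iterPderiv_or_eq_zero hf α with h | h
    · rw [h]
      exact zero_mem_lorentzian 2
    · exact mem_lorentzian_two_of_isRealStable hhom2 (coeff_iterPderiv_nonneg hnn α) h

/-- **`S^d_n ⊆ L^d_n`** with Brändén–Huh's convention "stable if non-vanishing on `ℋⁿ` or identically zero": a
degree-`d` form with nonnegative coefficients which is `0` or real stable is Lorentzian.
[cite: BrandenHuh2019, §2.1 Prop. 2.2 (and the definition of `S^d_n`)] -/
theorem mem_lorentzian_of_eq_zero_or_isRealStable {f : MvPolynomial σ ℝ} {d : ℕ} (hhom : f.IsHomogeneous d)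
    (hnn : ∀ m, 0 ≤ coeff m f) (hf : f = 0 ∨ IsRealStable f) : f ∈ lorentzian σ d := by
  rcases hf with rfl | hf
  · exact zero_mem_lorentzian d
  · exact mem_lorentzian_of_isRealStable hhom hnn hf

end StableLorentzian

/-! ## §5 Proposition 2.14 (first sentence): the Hessian of a stable form has exactly one positive eigenvalue -/

section HodgeRiemannStable

variable [Fintype σ] [DecidableEq σ]

/-- **Brändén–Huh, Proposition 2.14 (first sentence): "If `f` is in `S^d_n ∖ 0`, then `𝓗_f(w)` has exactly one
positive eigenvalue for all `w ∈ ℝⁿ_{>0}`"** (`d ≥ 2`; `sigPos = 1`), through Prop. 2.2 and Thm. 2.16 (2)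
(`sigPos_hessianAt_eq_one_of_mem_lorentzian`). [cite: BrandenHuh2019, §2.3 Prop. 2.14, Thm. 2.16 (2)] -/
theorem sigPos_hessianAt_eq_one_of_isRealStable {f : MvPolynomial σ ℝ} {d : ℕ} (hhom : f.IsHomogeneous d)
    (hd : 2 ≤ d) (hnn : ∀ m, 0 ≤ coeff m f) (hf : IsRealStable f) {w : σ → ℝ} (hw : ∀ k, 0 < w k) :
    sigPos (Matrix.toBilin' (hessianAt f w)).toQuadraticMap = 1 :=
  sigPos_hessianAt_eq_one_of_mem_lorentzian (mem_lorentzian_of_isRealStable hhom hnn hf) hd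
    (ne_zero_of_isRealStable hf) hw

end HodgeRiemannStable

/-! ## §6 Corollary 3.4 / [COSW04] Thm. 7.1: multi-affine homogeneous stable polynomials are supported on matroids -/

section Matroid

variable [Fintype σ] [DecidableEq σ]

omit [Fintype σ] [DecidableEq σ] in
/-- The support of a polynomial, as a set of exponents, is its Mathlib `support` (any coefficients).
[cite: BrandenHuh2019, §2.1 (p. 8, "the support of `f`")] -/
theorem coe_support_eq_setOf' {R : Type*} [CommSemiring R] (p : MvPolynomial σ R) :
    (p.support : Set (σ →₀ ℕ)) = {β : σ →₀ ℕ | coeff β p ≠ 0} := by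
  ext β
  rw [Finset.mem_coe, MvPolynomial.mem_support_iff, Set.mem_setOf_eq]

omit [DecidableEq σ] in
/-- From an M-convex support in `{0,1}ⁿ` to a matroid (Brändén–Huh Thm. 3.10 (7) ⟹ (8), `MathlibMatroid`).
[cite: BrandenHuh2019, §3.2 Thm. 3.10] [cite: Branden2007, §2] -/
theorem exists_basesExp_eq_support_of_isMConvex {R : Type*} [CommSemiring R] {p : MvPolynomial σ R}
    (hM : IsMConvex {β : σ →₀ ℕ | coeff β p ≠ 0}) (h01 : IsMultiAffine p) (hp0 : p ≠ 0) :
    ∃ M : Matroid σ, (basesExp M : Set (σ →₀ ℕ)) = {β : σ →₀ ℕ | coeff β p ≠ 0} := by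
  have hJ01 : ∀ α ∈ p.support, ∀ i, α i ≤ 1 := (isMultiAffine_iff_support p).1 h01
  have hne : p.support.Nonempty := by
    rw [Finset.nonempty_iff_ne_empty, Ne, MvPolynomial.support_eq_empty]
    exact hp0
  rw [← coe_support_eq_setOf'] at hM ⊢
  obtain ⟨M, hM'⟩ := (isMConvex_iff_exists_basesExp_eq hJ01 hne).1 hM
  exact ⟨M, by rw [hM']⟩

/-- **Brändén 2007, Corollary 3.4: "The support of a multi-affine and homogeneous polynomial with the half-plane
property is the set of bases of a matroid"** (= [COSW04] Thm. 7.1), with Mathlib's `Matroid σ`: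
`{e_B : B a base of M} = supp p`. [cite: Branden2007, §3 Cor. 3.4] [cite: ChoeOxleySokalWagner2004, Thm. 7.1] -/
theorem exists_basesExp_eq_support_of_hasHalfPlaneProperty {p : MvPolynomial σ ℂ} (hp : HasHalfPlaneProperty p)
    {d : ℕ} (hhom : p.IsHomogeneous d) (h01 : IsMultiAffine p) (hp0 : p ≠ 0) :
    ∃ M : Matroid σ, (basesExp M : Set (σ →₀ ℕ)) = {β : σ →₀ ℕ | coeff β p ≠ 0} :=
  exists_basesExp_eq_support_of_isMConvex (isMConvex_support_of_hasHalfPlaneProperty hp hhom) h01 hp0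

/-- **[COSW04] Thm. 7.1 for upper half-plane stable polynomials**: the support of a nonzero homogeneous multi-affine
stable polynomial is the set of bases of a matroid. [cite: Branden2007, §3 Cor. 3.4]
[cite: ChoeOxleySokalWagner2004, Thm. 7.1] -/
theorem exists_basesExp_eq_support_of_isUpperHalfPlaneStable {p : MvPolynomial σ ℂ} (hp : IsUpperHalfPlaneStable p)
    {d : ℕ} (hhom : p.IsHomogeneous d) (h01 : IsMultiAffine p) (hp0 : p ≠ 0) :
    ∃ M : Matroid σ, (basesExp M : Set (σ →₀ ℕ)) = {β : σ →₀ ℕ | coeff β p ≠ 0} :=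
  exists_basesExp_eq_support_of_isMConvex (isMConvex_support_of_isUpperHalfPlaneStable hp hhom) h01 hp0

/-- **Choe–Oxley–Sokal–Wagner in every degree** (as quoted by Brändén–Huh: "If `f` is a nonzero homogeneous stable
multi-affine polynomial, then the support of `f` is the set of bases of a matroid"), for a real stable homogeneous
multi-affine polynomial of degree `d`: its support is `{e_B : B a base of M}` for a matroid `M` on `σ` all of whose bases
have `d` elements. Upgrades `exists_basesExp_eq_support_of_isRealStable` (`d = 2`) of `SupportMatroid.lean`.
[cite: BrandenHuh2019, §2.4 (after Thm. 2.23, [COSW])] [cite: Branden2007, §3 Cor. 3.4]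
[cite: ChoeOxleySokalWagner2004, Thm. 7.1] -/
theorem exists_basesExp_eq_support_of_isRealStable_of_isHomogeneous {f : MvPolynomial σ ℝ} {d : ℕ}
    (hhom : f.IsHomogeneous d) (h01 : IsMultiAffine f) (hst : IsRealStable f) :
    ∃ M : Matroid σ, (basesExp M : Set (σ →₀ ℕ)) = {β : σ →₀ ℕ | coeff β f ≠ 0} ∧
      ∀ B, M.IsBase B → B.ncard = d := by
  obtain ⟨M, hM⟩ := exists_basesExp_eq_support_of_isMConvex (isMConvex_support_of_isRealStable hst hhom) h01
    (ne_zero_of_isRealStable hst)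
  refine ⟨M, hM, fun B hB => ?_⟩
  have hmem : indSet B ∈ (basesExp M : Set (σ →₀ ℕ)) := Finset.mem_coe.2 (indSet_mem_basesExp.2 hB)
  rw [hM, Set.mem_setOf_eq] at hmem
  rw [← degree_indSet B]
  by_contra hne
  exact hmem (hhom.coeff_eq_zero hne)

end Matroid

/-! ## §7 Proposition 2.2 up to sign: homogeneous real stable polynomials are `±`Lorentzian -/

section SignFree

variable [Fintype σ] [DecidableEq σ]

omit [Fintype σ] [DecidableEq σ] in
/-- `-f` is real stable iff `f` is. [cite: BorceaBranden2009, §1 (stable polynomials form a set closed under nonzero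
scalars)] -/
theorem IsRealStable.neg {f : MvPolynomial σ ℝ} (hf : IsRealStable f) : IsRealStable (-f) := by
  intro z hz h0
  refine hf z hz ?_
  rw [map_neg, map_neg, neg_eq_zero] at h0
  exact h0

/-- **Brändén–Huh Prop. 2.2 combined with the same-phase theorem [COSW04, Thm. 6.1]**: a homogeneous real stable
polynomial of degree `d` has all its coefficients of one sign (`IsRealStable.coeff_nonneg_or_nonpos`), hence `f` or
`-f` is Lorentzian (`S^d_n ∪ (-S^d_n) ⊆ L^d_n ∪ (-L^d_n)` for real stable forms without a sign condition).
[cite: BrandenHuh2019, §2.1 Prop. 2.2] [cite: ChoeOxleySokalWagner2004, §6 Thm. 6.1] -/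
theorem mem_lorentzian_or_neg_mem_lorentzian_of_isRealStable {f : MvPolynomial σ ℝ} {d : ℕ}
    (hhom : f.IsHomogeneous d) (hf : IsRealStable f) : f ∈ lorentzian σ d ∨ -f ∈ lorentzian σ d := by
  have hneg : IsRealStable (-f) := IsRealStable.neg hf
  rcases IsRealStable.coeff_nonneg_or_nonpos hhom hf with h | h
  · exact Or.inl (mem_lorentzian_of_isRealStable hhom h hf)
  · refine Or.inr (mem_lorentzian_of_isRealStable hhom.neg (fun m => ?_) hneg)
    rw [coeff_neg, neg_nonneg]
    exact h m

end SignFree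

end Literature.Combinatorics.LorentzianPolynomials

end
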